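import Mathlib
import HarnessLib
import Literature.Analysis.FluidPDE.KNSSAxisymmetricNoSwirl
import Literature.Analysis.FluidPDE.KNSSTypeIRateLiouvilleMild
import Literature.Analysis.FluidPDE.AlbrittonKatoClassIntegralForm
import Literature.Analysis.FluidPDE.VectorCalculus
import Summits.NavierStokesRegularity.NavierStokesRegularity.Theses.PoloidalWindowDoor
import Summits.NavierStokesRegularity.NavierStokesRegularity.Theorems.LocalSineTubeDoorProfileAlignedWindowRigidityAncient
import Summits.NavierStokesRegularity.NavierStokesRegularity.Theorems.LoopPeriodRatchetPeriodScalingBound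

/-!
# RUNG v6 (= v5 + `growthExponent_threeHalves` / `frequencyCeiling_threeHalves`: the FREE exponent κ = 3/2 named, sorry-free, = the tree's PROVED `LoopPeriodRatchet.PeriodScalingBound`, per idea-crit-7 10:06:56Z (2)); v5 (= v4 + the WEAK YORKE BOUND `one_le_lip_mul_period'` sorry-free, the pure-ODE period floor `periodFloor_of_lipschitz`, and the axisymmetric rung `frequencyGrowthExponent_rung_axisym` of the deciding stub S6G; v4 = v3 + `push_neg` lint fix) for line `thread_axis` (crux `PoloidalWindowRigidity`, stmt-NavierStokesRegularity-19708) — ns-idea-8 g2, BC5-style witness, SORRY-FREE.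

v2 of this file: the core is `slice_const_axisym` (every negative-time slice of an axisymmetric swirl-free class profile is constant), with two
corollaries in the exact shape of the skeleton's stubs — `threadAxis_rung_axisym` (S7 / former S4: irrotational open germ at `t = −1`) and
`noPeriodicVortexLine_rung_axisym` (S6: every periodic vortex line is stationary, all `t < 0`).

The deciding stub `stub_threadAxis` says: a profile of the route's Type-I ancient mild class, poloidal along `e₃`, normalised at a
MORSE hot spot, has an irrotational open germ at `t = −1`.  Its SIBLING CASE — the case the line transfers FROM — is decided:
for AXISYMMETRIC SWIRL-FREE profiles of the class (these are poloidal along `e₃`), the conclusion holds (indeed `curl v(−1) ≡ 0`),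
by Koch–Nadirashvili–Seregin–Šverák 2009, Theorem 5.2, used as the tree's NAMED FACT
`Literature.Analysis.FluidPDE.KNSS2009_liouville_axisymmetric_no_swirl` (hypothesis `h52`, the Literature convention for results in print).
Glue proved here: the route's class, shifted back in time by `1/2`, is a bounded ancient mild solution in duality form
(`isBoundedAncientMildSolution_of_oseen` + `oseenDuhamel_timeShift` + `IsDivFree.isWeaklyDivFree_holds` + joint analyticity
`analyticOnNhd_uncurry`), KNSS makes the slice `t = −1` a.e. constant, continuity makes it constant, and constants are curl-free.
No hot-spot / Morse hypothesis is even needed in the symmetric case.  This is NOT a proof of the stub, of K2, or of NS regularity.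
-/

noncomputable section

set_option linter.dupNamespace false
set_option linter.unusedVariables false

namespace Summit.NavierStokesRegularity.NavierStokesRegularity.Cruxes.PoloidalWindowRigidity.ThreadAxis.Rung

open MeasureTheory Set Function Filter Topology
open scoped RealInnerProductSpace InnerProductSpace Laplacian
open Literature.Analysis Literature.Analysis.FluidPDE Literature.Analysis.UnboundedOperators
open Summit.NavierStokesRegularity.NavierStokesRegularity.Theorems.LocalSineTubeDoorProfileAlignedWindowRigidityAncient

/-- The curl of a constant field vanishes. -/
theorem curl_const_eq_zero (c : EuclideanSpace ℝ (Fin 3)) (x : EuclideanSpace ℝ (Fin 3)) :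
    curl (fun _ : EuclideanSpace ℝ (Fin 3) => c) x = 0 := by
  ext i
  fin_cases i <;> simp [curl]

/-- **CORE (axisymmetric swirl-free slices of the class are constant; KNSS 2009 Thm 5.2 as a named fact).**  For every profile of the route's
Type-I ancient mild class whose negative-time slices are axisymmetric and swirl-free, every slice `v t₀`, `t₀ < 0`, is a constant field. -/
theorem slice_const_axisym (h52 : KNSS2009_liouville_axisymmetric_no_swirl)
    {C : ℝ} {v : ℝ → EuclideanSpace ℝ (Fin 3) → EuclideanSpace ℝ (Fin 3)}
    (hrate : HasTypeITimeDecay C v)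
    (hcont : ContinuousOn (uncurry v) (Iio (0 : ℝ) ×ˢ univ))
    (hmild : ∀ s t : ℝ, s < t → t < 0 → ∀ x, v t x = heatExtension (v s) (t - s) x - oseenDuhamel 1 s v v t x)
    (hdiv : ∀ t < 0, VectorCalculus.IsDivFree (v t))
    (haxi : ∀ t < 0, IsAxisymmetric (v t)) (hswirl : ∀ t < 0, HasNoSwirl (v t))
    {t₀ : ℝ} (ht₀ : t₀ < 0) :
    ∃ b : EuclideanSpace ℝ (Fin 3), v t₀ = fun _ => b := by
  -- the backward shift `δ = −t₀/2 > 0`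
  obtain ⟨δ, hδ, hδt⟩ : ∃ δ : ℝ, 0 < δ ∧ t₀ = -(2 * δ) := ⟨-t₀ / 2, by linarith, by ring⟩
  -- joint analyticity of the class ⇒ smooth slices
  have hana : AnalyticOnNhd ℝ (uncurry v) (Iio (0 : ℝ) ×ˢ univ) :=
    analyticOnNhd_uncurry hcont (bdd_of_hasTypeITimeDecay hrate) hmild
  have hslice : ∀ s < 0, AnalyticOnNhd ℝ (v s) univ := by
    intro s hs x _
    have h := hana (s, x) ⟨hs, mem_univ _⟩
    have hι : AnalyticAt ℝ (fun y : EuclideanSpace ℝ (Fin 3) => ((s, y) : ℝ × EuclideanSpace ℝ (Fin 3))) x :=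
      analyticAt_const.prod analyticAt_id
    exact h.comp hι
  have hC1 : ∀ s < 0, ContDiff ℝ 1 (v s) := fun s hs =>
    contDiffOn_univ.1 ((hslice s hs).contDiffOn (n := 1) uniqueDiffOn_univ)
  have hvc : ∀ s < 0, Continuous (v s) := fun s hs => (hC1 s hs).continuous
  -- the shifted field `W τ = v (τ − δ)` on `τ < 0`
  have hWcont : ContinuousOn (uncurry (fun τ : ℝ => v (τ - δ))) (Iio (0 : ℝ) ×ˢ univ) := by
    have hφ : Continuous (fun p : ℝ × EuclideanSpace ℝ (Fin 3) => (p.1 - δ, p.2)) := by fun_prop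
    have hmaps : MapsTo (fun p : ℝ × EuclideanSpace ℝ (Fin 3) => (p.1 - δ, p.2))
        (Iio (0 : ℝ) ×ˢ univ) (Iio (0 : ℝ) ×ˢ univ) := by
      intro p hp
      obtain ⟨h1, -⟩ := mem_prod.1 hp
      refine mem_prod.2 ⟨?_, mem_univ _⟩
      simp only [mem_Iio] at h1 ⊢
      linarith
    have hcomp : uncurry (fun τ : ℝ => v (τ - δ)) =
        uncurry v ∘ (fun p : ℝ × EuclideanSpace ℝ (Fin 3) => (p.1 - δ, p.2)) := by
      funext p
      rfl
    rw [hcomp]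
    exact hcont.comp hφ.continuousOn hmaps
  have hWbdd : ∃ K : ℝ, ∀ t < 0, ∀ x, ‖(fun τ : ℝ => v (τ - δ)) t x‖ ≤ K := by
    obtain ⟨B, hB⟩ := bdd_of_hasTypeITimeDecay hrate (δ / 2) (by linarith)
    exact ⟨B, fun t ht x => hB (t - δ) (by linarith) x⟩
  have hWdiv : ∀ t < 0, IsWeaklyDivFree ((fun τ : ℝ => v (τ - δ)) t) := by
    intro t ht
    exact VectorCalculus.IsDivFree.isWeaklyDivFree_holds (hdiv (t - δ) (by linarith)) (hC1 (t - δ) (by linarith))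
  have hWmild : ∀ s t : ℝ, s < t → t < 0 → ∀ x,
      (fun τ : ℝ => v (τ - δ)) t x =
        heatExtension ((fun τ : ℝ => v (τ - δ)) s) (1 * (t - s)) x -
          oseenDuhamel 1 s (fun τ : ℝ => v (τ - δ)) (fun τ : ℝ => v (τ - δ)) t x := by
    intro s t hst ht x
    have e1 := hmild (s - δ) (t - δ) (by linarith) (by linarith) x
    rw [show t - δ - (s - δ) = t - s by ring] at e1
    have h1 := oseenDuhamel_timeShift 1 s (fun τ => v (τ + s - δ)) (fun τ => v (τ + s - δ)) t x
    have h2 := oseenDuhamel_timeShift 1 (s - δ) (fun τ => v (τ + s - δ)) (fun τ => v (τ + s - δ)) (t - δ) x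
    have hf1 : (fun τ : ℝ => (fun τ' : ℝ => v (τ' + s - δ)) (τ - s)) = fun τ : ℝ => v (τ - δ) := by
      funext τ
      simp only
      congr 1
      ring
    have hf2 : (fun τ : ℝ => (fun τ' : ℝ => v (τ' + s - δ)) (τ - (s - δ))) = v := by
      funext τ
      simp only
      congr 1
      ring
    rw [hf1] at h1
    rw [hf2, show t - δ - (s - δ) = t - s by ring] at h2
    beta_reduce
    rw [one_mul, h1, ← h2]
    exact e1
  -- KNSS Theorem 5.2 (named fact) in the mild class
  have hBAMS : IsBoundedAncientMildSolution 1 (fun τ : ℝ => v (τ - δ)) :=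
    isBoundedAncientMildSolution_of_oseen one_pos hWcont hWbdd hWdiv hWmild
  have hjoint : AEStronglyMeasurable (uncurry (fun τ : ℝ => v (τ - δ)))
      (volume.restrict (Iio (0 : ℝ) ×ˢ (univ : Set (EuclideanSpace ℝ (Fin 3))))) :=
    hWcont.aestronglyMeasurable (measurableSet_Iio.prod MeasurableSet.univ)
  have hmeas : ∀ t < 0, AEStronglyMeasurable ((fun τ : ℝ => v (τ - δ)) t) volume :=
    fun t ht => (hvc (t - δ) (by linarith)).aestronglyMeasurable
  have haxiW : ∀ t < 0, IsAxisymmetric ((fun τ : ℝ => v (τ - δ)) t) := fun t ht => haxi (t - δ) (by linarith)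
  have hswW : ∀ t < 0, HasNoSwirl ((fun τ : ℝ => v (τ - δ)) t) := fun t ht => hswirl (t - δ) (by linarith)
  obtain ⟨β, hβ⟩ := knss2009_axisymmetric_no_swirl_of_KNSS2009 h52 hBAMS hjoint hmeas haxiW hswW (-δ) (by linarith)
  have hβ' : v t₀ =ᵐ[volume] fun _ => β • eZ := by
    have h1 : v t₀ = v (-δ - δ) := by
      rw [hδt]
      congr 1
      ring
    rw [h1]
    exact hβ
  exact ⟨β • eZ, ((hvc t₀ ht₀).ae_eq_iff_eq volume continuous_const).1 hβ'⟩

/-- **RUNG for S7 / the former S4 (axisymmetric swirl-free case of «a Morse hot spot is an irrotational germ»).**  For every profile of the route's Type-I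
ancient mild class whose negative-time slices are axisymmetric and swirl-free, the slice `t = −1` is irrotational on a nonempty open set (in fact
everywhere) — no hot-spot or Morse hypothesis is needed in the symmetric case. -/
theorem threadAxis_rung_axisym (h52 : KNSS2009_liouville_axisymmetric_no_swirl)
    {C : ℝ} {v : ℝ → EuclideanSpace ℝ (Fin 3) → EuclideanSpace ℝ (Fin 3)}
    (hrate : HasTypeITimeDecay C v)
    (hcont : ContinuousOn (uncurry v) (Iio (0 : ℝ) ×ˢ univ))
    (hmild : ∀ s t : ℝ, s < t → t < 0 → ∀ x, v t x = heatExtension (v s) (t - s) x - oseenDuhamel 1 s v v t x)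
    (hdiv : ∀ t < 0, VectorCalculus.IsDivFree (v t))
    (haxi : ∀ t < 0, IsAxisymmetric (v t)) (hswirl : ∀ t < 0, HasNoSwirl (v t)) :
    ∃ U : Set (EuclideanSpace ℝ (Fin 3)), IsOpen U ∧ U.Nonempty ∧ ∀ y ∈ U, curl (v (-1)) y = 0 := by
  obtain ⟨b, hb⟩ := slice_const_axisym h52 hrate hcont hmild hdiv haxi hswirl (t₀ := -1) (by norm_num)
  refine ⟨univ, isOpen_univ, univ_nonempty, fun y _ => ?_⟩
  rw [hb]
  exact curl_const_eq_zero _ y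

/-- **RUNG for S6 `stub_noPeriodicVortexLine` (axisymmetric swirl-free case of «no periodic vortex line»).**  For every profile of the route's Type-I
ancient mild class whose negative-time slices are axisymmetric and swirl-free, every periodic integral curve of the vorticity field `ω(t,·)`, `t < 0`,
consists of zeros of `ω(t,·)` — S6's conclusion verbatim (the vorticity vanishes identically). -/
theorem noPeriodicVortexLine_rung_axisym (h52 : KNSS2009_liouville_axisymmetric_no_swirl)
    {C : ℝ} {v : ℝ → EuclideanSpace ℝ (Fin 3) → EuclideanSpace ℝ (Fin 3)}
    (hrate : HasTypeITimeDecay C v)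
    (hcont : ContinuousOn (uncurry v) (Iio (0 : ℝ) ×ˢ univ))
    (hmild : ∀ s t : ℝ, s < t → t < 0 → ∀ x, v t x = heatExtension (v s) (t - s) x - oseenDuhamel 1 s v v t x)
    (hdiv : ∀ t < 0, VectorCalculus.IsDivFree (v t))
    (haxi : ∀ t < 0, IsAxisymmetric (v t)) (hswirl : ∀ t < 0, HasNoSwirl (v t)) :
    ∀ t < 0, ∀ (c : ℝ → EuclideanSpace ℝ (Fin 3)) (T : ℝ), 0 < T → Function.Periodic c T →
      (∀ s, HasDerivAt c (curl (v t) (c s)) s) → ∀ s, curl (v t) (c s) = 0 := by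
  intro t ht c T _ _ _ s
  obtain ⟨b, hb⟩ := slice_const_axisym h52 hrate hcont hmild hdiv haxi hswirl ht
  rw [hb]
  exact curl_const_eq_zero _ (c s)

/-- A WEAK YORKE BOUND (elementary, integral-free): a non-stationary `T`-periodic orbit of an `L`-Lipschitz field has `1 ≤ L·T`.
(Yorke 1969 gives the sharp `2π ≤ L·T`; any positive constant suffices for the period floor.) -/
theorem one_le_lip_mul_period' {E : Type*} [NormedAddCommGroup E] [InnerProductSpace ℝ E]
    {F : E → E} {L : ℝ} (hL : 0 ≤ L) (hF : ∀ x y, ‖F x - F y‖ ≤ L * ‖x - y‖)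
    {c : ℝ → E} {T : ℝ} (hT : 0 < T) (hper : Function.Periodic c T) (hder : ∀ s, HasDerivAt c (F (c s)) s)
    (hnz : ∃ s, F (c s) ≠ 0) : 1 ≤ L * T := by
  have hc : Continuous c := continuous_iff_continuousAt.2 fun s => (hder s).continuousAt
  have hFc : Continuous F := by
    refine continuous_iff_continuousAt.2 fun x => ?_
    rw [ContinuousAt, tendsto_iff_norm_sub_tendsto_zero]
    refine squeeze_zero (fun _ => norm_nonneg _) (fun y => hF y x) ?_
    have : Tendsto (fun y => L * ‖y - x‖) (𝓝 x) (𝓝 (L * ‖x - x‖)) :=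
      ((continuous_const.mul (continuous_norm.comp (continuous_id.sub continuous_const))).tendsto x)
    simpa using this
  have hw : Continuous fun s => ‖F (c s)‖ := continuous_norm.comp (hFc.comp hc)
  -- maximiser of ‖c'‖ on [0,T]
  obtain ⟨tm, htm, hmax⟩ := (isCompact_Icc : IsCompact (Icc (0:ℝ) T)).exists_isMaxOn
    (nonempty_Icc.2 hT.le) hw.continuousOn
  set a : E := F (c tm) with ha
  set M : ℝ := ‖a‖ with hM
  -- global bound ‖F (c s)‖ ≤ M via periodicity
  have hbound : ∀ s, ‖F (c s)‖ ≤ M := by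
    intro s
    obtain ⟨y, hy, hyx⟩ := hper.exists_mem_Ico₀ hT s
    rw [hyx]; exact hmax (Ico_subset_Icc_self hy)
  -- M > 0
  have hMpos : 0 < M := by
    obtain ⟨s₀, hs₀⟩ := hnz
    exact lt_of_lt_of_le (norm_pos_iff.2 hs₀) (hbound s₀)
  -- some s ∈ [0,T] with ⟪F (c s), a⟫ ≤ 0
  have hexists : ∃ s ∈ Icc (0:ℝ) T, inner ℝ (F (c s)) a ≤ 0 := by
    by_contra hcon
    push Not at hcon
    set g : ℝ → ℝ := fun s => inner ℝ (c s) a with hg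
    have hgd : ∀ s, HasDerivAt g (inner ℝ (F (c s)) a) s := fun s =>
      (hder s).inner ℝ (hasDerivAt_const s a) |>.congr_deriv (by simp)
    have hmono : StrictMonoOn g (Icc 0 T) := by
      refine strictMonoOn_of_deriv_pos (convex_Icc 0 T)
        (continuous_iff_continuousAt.2 fun s => (hgd s).continuousAt).continuousOn ?_
      intro s hs
      rw [interior_Icc] at hs
      rw [(hgd s).deriv]; exact hcon s (Ioo_subset_Icc_self hs)
    have : g 0 < g T := hmono (left_mem_Icc.2 hT.le) (right_mem_Icc.2 hT.le) hT
    have hgT : g T = g 0 := by simp only [hg]; rw [show (T:ℝ) = 0 + T by ring, hper 0]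
    linarith
  obtain ⟨s, hs, hinner⟩ := hexists
  -- ‖a - F (c s)‖ ≥ M
  have h1 : M ≤ ‖a - F (c s)‖ := by
    have hsq : ‖a‖ ^ 2 ≤ ‖a - F (c s)‖ ^ 2 := by
      rw [norm_sub_sq_real]
      have : inner ℝ a (F (c s)) ≤ 0 := by rwa [real_inner_comm]
      nlinarith [norm_nonneg (F (c s)), sq_nonneg ‖F (c s)‖]
    have hx : 0 ≤ ‖a - F (c s)‖ := norm_nonneg _
    rw [hM]
    nlinarith [hsq, hx, norm_nonneg a, hMpos]
  -- ‖a - F (c s)‖ ≤ L ‖c tm - c s‖ ≤ L M |tm - s| ≤ L M T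
  have h2 : ‖a - F (c s)‖ ≤ L * ‖c tm - c s‖ := hF _ _
  have hseg : ∀ p q : ℝ, p ≤ q → ‖c q - c p‖ ≤ M * (q - p) := by
    intro p q hpq
    have := norm_image_sub_le_of_norm_deriv_le_segment' (f := c) (f' := fun s => F (c s)) (a := p) (b := q)
      (fun x _ => (hder x).hasDerivWithinAt) (fun x _ => hbound x) q (right_mem_Icc.2 hpq)
    simpa using this
  have h3 : ‖c tm - c s‖ ≤ M * T := by
    rcases le_total s tm with hle | hle
    · calc ‖c tm - c s‖ ≤ M * (tm - s) := hseg s tm hle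
        _ ≤ M * T := by apply mul_le_mul_of_nonneg_left _ hMpos.le; linarith [htm.2, hs.1]
    · calc ‖c tm - c s‖ = ‖c s - c tm‖ := norm_sub_rev _ _
        _ ≤ M * (s - tm) := hseg tm s hle
        _ ≤ M * T := by apply mul_le_mul_of_nonneg_left _ hMpos.le; linarith [hs.2, htm.1]
  have : M ≤ L * (M * T) := le_trans h1 (le_trans h2 (mul_le_mul_of_nonneg_left h3 hL))
  by_contra hlt
  push Not at hlt
  have : M * 1 ≤ M * (L * T) := by linarith
  have := le_of_mul_le_mul_left this hMpos
  linarith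

/-- **RUNG for S6G (v5: the axisymmetric swirl-free case of the deciding stub `stub_frequencyGrowthExponent`, BC5-style witness).**
In the KNSS regime every slice is constant (`slice_const_axisym`), so there is no non-stationary periodic vortex line at any time and the
growth-exponent statement holds (vacuously) with ANY admissible constants — here `A = 1`, `κ = 0`. -/
theorem frequencyGrowthExponent_rung_axisym (h52 : KNSS2009_liouville_axisymmetric_no_swirl)
    {C : ℝ} {v : ℝ → EuclideanSpace ℝ (Fin 3) → EuclideanSpace ℝ (Fin 3)}
    (hrate : HasTypeITimeDecay C v)
    (hcont : ContinuousOn (uncurry v) (Iio (0 : ℝ) ×ˢ univ))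
    (hmild : ∀ s t : ℝ, s < t → t < 0 → ∀ x, v t x = heatExtension (v s) (t - s) x - oseenDuhamel 1 s v v t x)
    (hdiv : ∀ t < 0, VectorCalculus.IsDivFree (v t))
    (haxi : ∀ t < 0, IsAxisymmetric (v t)) (hswirl : ∀ t < 0, HasNoSwirl (v t)) :
    ∃ A κ : ℝ, 0 < A ∧ κ < 3 / 2 ∧ ∀ t₀ t : ℝ, t₀ ≤ t → t < 0 →
      ∀ (c : ℝ → EuclideanSpace ℝ (Fin 3)) (T : ℝ), 0 < T → Function.Periodic c T →
        (∀ s, HasDerivAt c (curl (v t) (c s)) s) →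
        (∃ s, curl (v t) (c s) ≠ 0) →
        ∃ (c₀ : ℝ → EuclideanSpace ℝ (Fin 3)) (T₀ : ℝ), 0 < T₀ ∧ Function.Periodic c₀ T₀ ∧
          (∀ s, HasDerivAt c₀ (curl (v t₀) (c₀ s)) s) ∧
          (∃ s, curl (v t₀) (c₀ s) ≠ 0) ∧
          T₀ ≤ A * T * ((-t₀) / (-t)) ^ κ := by
  refine ⟨1, 0, one_pos, by norm_num, fun t₀ t _ ht c T hT hper hder hnz => ?_⟩
  obtain ⟨s, hs⟩ := hnz
  exact absurd (noPeriodicVortexLine_rung_axisym h52 hrate hcont hmild hdiv haxi hswirl t ht c T hT hper hder s) hs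

/-- **RUNG for S6L (v5: the weak Yorke bound specialised — any field that is `L(t)`-Lipschitz with `L(t) = C₂ (−t)^{−3/2}` has the period floor
`(1/C₂)(−t)^{3/2} ≤ T`; pure ODE, no fluid input).**  This is the part of S6Y that does not depend on the smoothing stub, stated for an arbitrary
time-dependent field `ω` on `ℝ³`; it is what `periodFloorYorke` in the skeleton applies to `ω = curl ∘ v`. -/
theorem periodFloor_of_lipschitz {ω : ℝ → EuclideanSpace ℝ (Fin 3) → EuclideanSpace ℝ (Fin 3)} {C₂ : ℝ} (hC₂ : 0 < C₂)
    (hLip : ∀ t < 0, ∀ x y : EuclideanSpace ℝ (Fin 3), (-t) ^ ((3 : ℝ) / 2) * ‖ω t x - ω t y‖ ≤ C₂ * ‖x - y‖) :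
    ∀ t < 0, ∀ (c : ℝ → EuclideanSpace ℝ (Fin 3)) (T : ℝ), 0 < T → Function.Periodic c T →
      (∀ s, HasDerivAt c (ω t (c s)) s) → (∃ s, ω t (c s) ≠ 0) → (1 / C₂) * (-t) ^ ((3 : ℝ) / 2) ≤ T := by
  intro t ht c T hT hper hder hnz
  have hmt : 0 < (-t) ^ ((3 : ℝ) / 2) := Real.rpow_pos_of_pos (by linarith) _
  have hF : ∀ x y : EuclideanSpace ℝ (Fin 3), ‖ω t x - ω t y‖ ≤ C₂ / (-t) ^ ((3 : ℝ) / 2) * ‖x - y‖ := by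
    intro x y
    rw [div_mul_eq_mul_div, le_div_iff₀ hmt, mul_comm]
    exact hLip t ht x y
  have key := one_le_lip_mul_period' (by positivity) hF hT hper hder hnz
  rw [div_mul_eq_mul_div, le_div_iff₀ hmt] at key
  rw [div_mul_eq_mul_div, div_le_iff₀ hC₂]
  linarith

/-- **RUNG S5a (time pin; the `∂ₜ` half of the shared provable stub `stub_threadSignedPin`, sorry-free).**
At the hot spot `(−1, 0)` of `√(−t)|v_z|` over the whole past, the time derivative of `v_z` is PINNED:
`∂ₜ v_z(−1,0) = v_z(−1,0)/2` — Fermat in `t` for `s ↦ √(−s)·σ·v_z(s,0)` (`σ = sign v_z(−1,0)`), time-differentiability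
from the joint analyticity of the class (`analyticOnNhd_uncurry`). -/
theorem threadTimePin {v : ℝ → EuclideanSpace ℝ (Fin 3) → EuclideanSpace ℝ (Fin 3)} {C : ℝ}
    (hrate : HasTypeITimeDecay C v)
    (hcont : ContinuousOn (uncurry v) (Iio (0 : ℝ) ×ˢ univ))
    (hmild : ∀ s t : ℝ, s < t → t < 0 → ∀ x, v t x = heatExtension (v s) (t - s) x - oseenDuhamel 1 s v v t x)
    (hne : v (-1) 0 2 ≠ 0) (hhot : ∀ t < 0, ∀ x, Real.sqrt (-t) * |v t x 2| ≤ |v (-1) 0 2|) :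
    deriv (fun s => v s 0 2) (-1) = v (-1) 0 2 / 2 := by
  -- time-differentiability of `s ↦ v_z(s,0)` at `s = −1`
  have han := analyticOnNhd_uncurry hcont (bdd_of_hasTypeITimeDecay hrate) hmild
  have hmem : ((-1 : ℝ), (0 : EuclideanSpace ℝ (Fin 3))) ∈ Iio (0 : ℝ) ×ˢ (univ : Set (EuclideanSpace ℝ (Fin 3))) :=
    mem_prod.2 ⟨by norm_num, mem_univ _⟩
  have hA : AnalyticAt ℝ (uncurry v) ((-1 : ℝ), (0 : EuclideanSpace ℝ (Fin 3))) := han _ hmem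
  have h1 : DifferentiableAt ℝ (fun s : ℝ => (s, (0 : EuclideanSpace ℝ (Fin 3)))) (-1) :=
    differentiableAt_id.prodMk (differentiableAt_const _)
  have h2 : DifferentiableAt ℝ (uncurry v ∘ fun s : ℝ => (s, (0 : EuclideanSpace ℝ (Fin 3)))) (-1) :=
    hA.differentiableAt.comp (-1) h1
  have hfd : DifferentiableAt ℝ (fun s => v s 0 2) (-1) :=
    ((EuclideanSpace.proj (𝕜 := ℝ) (2 : Fin 3)).differentiableAt).comp (-1) h2
  -- the sign `σ` of `v_z(−1,0)`
  obtain ⟨σ, hσabs, hσa⟩ : ∃ σ : ℝ, |σ| = 1 ∧ σ * v (-1) 0 2 = |v (-1) 0 2| := by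
    rcases lt_or_gt_of_ne hne with h | h
    · exact ⟨-1, by simp, by rw [abs_of_neg h]; ring⟩
    · exact ⟨1, by simp, by rw [abs_of_pos h]; ring⟩
  have hσle : ∀ y : ℝ, σ * y ≤ |y| := fun y =>
    calc σ * y ≤ |σ * y| := le_abs_self _
      _ = |y| := by rw [abs_mul, hσabs, one_mul]
  have hσne : σ ≠ 0 := fun h0 => by rw [h0, abs_zero] at hσabs; exact zero_ne_one hσabs
  -- `g(s) = √(−s)·σ·v_z(s,0)` has a local maximum at `s = −1`
  have hgmax : IsLocalMax (fun s : ℝ => Real.sqrt (-s) * (σ * v s 0 2)) (-1) := by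
    have hnhds : ∀ᶠ s in 𝓝 (-1 : ℝ), s < 0 := Iio_mem_nhds (by norm_num)
    filter_upwards [hnhds] with s hs
    have hR : Real.sqrt (-(-1 : ℝ)) = 1 := by norm_num
    rw [hR, one_mul]
    calc Real.sqrt (-s) * (σ * v s 0 2) ≤ Real.sqrt (-s) * |v s 0 2| :=
          mul_le_mul_of_nonneg_left (hσle _) (Real.sqrt_nonneg _)
      _ ≤ |v (-1) 0 2| := hhot s hs 0
      _ = σ * v (-1) 0 2 := hσa.symm
  have hderiv0 := hgmax.deriv_eq_zero
  -- product rule at `s = −1`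
  have hsqrt : HasDerivAt (fun s : ℝ => Real.sqrt (-s)) (1 / (2 * Real.sqrt (-(-1 : ℝ))) * (-1)) (-1) := by
    have hneg : HasDerivAt (fun s : ℝ => -s) (-1) (-1) := hasDerivAt_neg (-1 : ℝ)
    have hs : HasDerivAt Real.sqrt (1 / (2 * Real.sqrt (-(-1 : ℝ)))) (-(-1 : ℝ)) :=
      Real.hasDerivAt_sqrt (by norm_num)
    exact hs.comp (-1) hneg
  have hg' := hsqrt.mul (hfd.hasDerivAt.const_mul σ)
  have hzero := hg'.deriv.symm.trans hderiv0
  have hR : Real.sqrt (-(-1 : ℝ)) = 1 := by norm_num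
  rw [hR] at hzero
  have hkey : σ * (deriv (fun s => v s 0 2) (-1) - v (-1) 0 2 / 2) = 0 := by linear_combination hzero
  rcases mul_eq_zero.1 hkey with h0 | h0
  · exact absurd h0 hσne
  · linarith

/-- 1-D necessity half of the second-derivative test: a `C²` function with a local maximum at `0` has `φ″(0) ≤ 0`. -/
theorem deriv2_nonpos_of_isLocalMax {φ : ℝ → ℝ} (hφ : ContDiff ℝ 2 φ) (hmax : IsLocalMax φ 0) :
    deriv (deriv φ) 0 ≤ 0 := by
  by_contra hpos
  push Not at hpos
  have hd1 : deriv φ 0 = 0 := hmax.deriv_eq_zero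
  have hsign := eventually_nhdsWithin_sign_eq_of_deriv_pos hpos hd1
  obtain ⟨ε, hε, hball⟩ := Metric.eventually_nhds_iff.1 (hsign.and hmax)
  have hdiff : Differentiable ℝ φ := hφ.differentiable (by norm_num)
  have hpos' : ∀ x : ℝ, 0 < x → x < ε → 0 < deriv φ x := by
    intro x hx0 hxε
    have hx : dist x 0 < ε := by rw [Real.dist_eq, sub_zero, abs_of_pos hx0]; exact hxε
    have h := (hball hx).1
    rw [sub_zero, sign_pos hx0, sign_eq_one_iff] at h
    exact h
  obtain ⟨c, hc, hcd⟩ := exists_deriv_eq_slope φ (by linarith : (0 : ℝ) < ε / 2)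
    hdiff.continuous.continuousOn (hdiff.differentiableOn)
  have h1 : 0 < deriv φ c := hpos' c hc.1 (by linarith [hc.2])
  have hε2 : dist (ε / 2) 0 < ε := by rw [Real.dist_eq, sub_zero, abs_of_pos (by linarith)]; linarith
  have h2 : φ (ε / 2) ≤ φ 0 := (hball hε2).2
  rw [hcd, sub_zero] at h1
  have h3 : 0 < φ (ε / 2) - φ 0 := (div_pos_iff_of_pos_right (by linarith)).1 h1
  linarith

/-- The second derivative of a `C²` function along a line is the second Fréchet derivative on the diagonal. -/
theorem deriv2_line_eq_iteratedFDeriv {f : EuclideanSpace ℝ (Fin 3) → ℝ} (hf : ContDiff ℝ 2 f)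
    (x w : EuclideanSpace ℝ (Fin 3)) :
    deriv (deriv (fun t : ℝ => f (x + t • w))) 0 = iteratedFDeriv ℝ 2 f x ![w, w] := by
  have hd : Differentiable ℝ f := hf.differentiable (by norm_num)
  have hd2 : Differentiable ℝ (fderiv ℝ f) :=
    (hf.fderiv_right (m := 1) (by norm_num)).differentiable one_ne_zero
  have hline : ∀ t : ℝ, HasDerivAt (fun t : ℝ => x + t • w) w t := fun t => by
    simpa using ((hasDerivAt_id t).smul_const w).const_add x
  have h1 : ∀ t : ℝ, HasDerivAt (fun t : ℝ => f (x + t • w)) (fderiv ℝ f (x + t • w) w) t := fun t =>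
    (hd (x + t • w)).hasFDerivAt.comp_hasDerivAt t (hline t)
  have h1' : deriv (fun t : ℝ => f (x + t • w)) = fun t => fderiv ℝ f (x + t • w) w :=
    funext fun t => (h1 t).deriv
  rw [h1']
  have hc : HasDerivAt (fun t : ℝ => fderiv ℝ f (x + t • w)) (fderiv ℝ (fderiv ℝ f) (x + (0 : ℝ) • w) w) 0 :=
    (hd2 (x + (0 : ℝ) • w)).hasFDerivAt.comp_hasDerivAt (0 : ℝ) (hline 0)
  have h2 := hc.clm_apply (hasDerivAt_const (0 : ℝ) w)
  rw [h2.deriv, iteratedFDeriv_two_apply]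
  simp

/-- **RUNG S5b (space pin; the Laplacian half of the shared provable stub `stub_threadSignedPin`, sorry-free).**
At the hot spot `(−1,0)`, `v_z(−1,·)` attains `max |v_z(−1,·)|` at `0` (the weight `√(−t)` is `1` at `t = −1`), so
`v_z(−1,0) · Δ v_z(−1,·)(0) ≤ 0` — each pure second derivative of `σ·v_z(−1,·)` along a line through `0` is `≤ 0`
(1-D necessity) and the Laplacian is their sum over an orthonormal basis; `C²` from the slice analyticity of the class. -/
theorem threadSpacePin {v : ℝ → EuclideanSpace ℝ (Fin 3) → EuclideanSpace ℝ (Fin 3)} {C : ℝ}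
    (hrate : HasTypeITimeDecay C v)
    (hcont : ContinuousOn (uncurry v) (Iio (0 : ℝ) ×ˢ univ))
    (hmild : ∀ s t : ℝ, s < t → t < 0 → ∀ x, v t x = heatExtension (v s) (t - s) x - oseenDuhamel 1 s v v t x)
    (hne : v (-1) 0 2 ≠ 0) (hhot : ∀ t < 0, ∀ x, Real.sqrt (-t) * |v t x 2| ≤ |v (-1) 0 2|) :
    v (-1) 0 2 * (Δ (fun y => v (-1) y 2)) 0 ≤ 0 := by
  set f : EuclideanSpace ℝ (Fin 3) → ℝ := fun y => v (-1) y 2 with hf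
  have hfa : ContDiff ℝ 2 f := by
    have hsl := analyticOnNhd_slice hcont (bdd_of_hasTypeITimeDecay hrate) hmild (by norm_num : (-1 : ℝ) < 0)
    have han : AnalyticOnNhd ℝ f univ := fun y _ =>
      ((EuclideanSpace.proj (𝕜 := ℝ) (2 : Fin 3)).analyticAt _).comp (hsl y (mem_univ _))
    exact han.contDiff
  obtain ⟨σ, hσabs, hσa⟩ : ∃ σ : ℝ, |σ| = 1 ∧ σ * v (-1) 0 2 = |v (-1) 0 2| := by
    rcases lt_or_gt_of_ne hne with h | h
    · exact ⟨-1, by simp, by rw [abs_of_neg h]; ring⟩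
    · exact ⟨1, by simp, by rw [abs_of_pos h]; ring⟩
  have hσle : ∀ y : ℝ, σ * y ≤ |y| := fun y =>
    calc σ * y ≤ |σ * y| := le_abs_self _
      _ = |y| := by rw [abs_mul, hσabs, one_mul]
  have hσ2 : σ * σ = 1 := by
    have h := congrArg (fun r : ℝ => r ^ 2) hσabs
    simp only [sq_abs, one_pow] at h
    nlinarith [h]
  -- every pure second derivative of `σ f` through `0` is `≤ 0`
  have hw : ∀ w : EuclideanSpace ℝ (Fin 3), σ * iteratedFDeriv ℝ 2 f 0 ![w, w] ≤ 0 := by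
    intro w
    have hφc : ContDiff ℝ 2 (fun t : ℝ => σ * f (0 + t • w)) :=
      contDiff_const.mul (hfa.comp (contDiff_const.add (contDiff_id.smul contDiff_const)))
    have hmax : IsLocalMax (fun t : ℝ => σ * f (0 + t • w)) 0 := by
      refine Filter.Eventually.of_forall fun t => ?_
      show σ * f (0 + t • w) ≤ σ * f (0 + (0 : ℝ) • w)
      simp only [zero_smul, add_zero, zero_add]
      have hh := hhot (-1) (by norm_num) (t • w)
      have hR : Real.sqrt (-(-1 : ℝ)) = 1 := by norm_num
      rw [hR, one_mul] at hh
      calc σ * f (t • w) ≤ |f (t • w)| := hσle _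
        _ ≤ |v (-1) 0 2| := hh
        _ = σ * f 0 := hσa.symm
    have hA := deriv2_nonpos_of_isLocalMax hφc hmax
    have hB : deriv (deriv (fun t : ℝ => σ * f (0 + t • w))) 0 = σ * iteratedFDeriv ℝ 2 f 0 ![w, w] := by
      rw [← deriv2_line_eq_iteratedFDeriv hfa 0 w]
      have e1 : deriv (fun t : ℝ => σ * f (0 + t • w)) = fun t => σ * deriv (fun t : ℝ => f (0 + t • w)) t :=
        deriv_const_mul_field' σ
      rw [e1, deriv_const_mul_field']
    rw [hB] at hA
    exact hA
  rw [InnerProductSpace.laplacian_eq_iteratedFDeriv_orthonormalBasis f (EuclideanSpace.basisFun (Fin 3) ℝ)]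
  have hS : σ * ∑ i, iteratedFDeriv ℝ 2 f 0
      ![(EuclideanSpace.basisFun (Fin 3) ℝ) i, (EuclideanSpace.basisFun (Fin 3) ℝ) i] ≤ 0 := by
    rw [Finset.mul_sum]
    exact Finset.sum_nonpos fun i _ => hw _
  have haσ : v (-1) 0 2 = |v (-1) 0 2| * σ := by
    calc v (-1) 0 2 = (σ * σ) * v (-1) 0 2 := by rw [hσ2, one_mul]
      _ = (σ * v (-1) 0 2) * σ := by ring
      _ = |v (-1) 0 2| * σ := by rw [hσa]
  rw [haσ, mul_assoc]
  exact mul_nonpos_of_nonneg_of_nonpos (abs_nonneg _) hS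

/-- **RUNG S5 (the shared provable stub `stub_threadSignedPin`, PROVED — statement verbatim).** -/
theorem threadSignedPin_holds :
    ∀ (C : ℝ) (v : ℝ → EuclideanSpace ℝ (Fin 3) → EuclideanSpace ℝ (Fin 3)),
      Literature.Analysis.FluidPDE.HasTypeITimeDecay C v →
      ContinuousOn (Function.uncurry v) (Set.Iio (0 : ℝ) ×ˢ Set.univ) →
      (∀ s t : ℝ, s < t → t < 0 → ∀ x, v t x =
        Literature.Analysis.UnboundedOperators.heatExtension (v s) (t - s) x -
          Literature.Analysis.FluidPDE.oseenDuhamel 1 s v v t x) →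
      (∀ t < 0, Literature.Analysis.FluidPDE.VectorCalculus.IsDivFree (v t)) →
      v (-1) 0 2 ≠ 0 → (∀ t < 0, ∀ x, Real.sqrt (-t) * |v t x 2| ≤ |v (-1) 0 2|) →
      (deriv (fun s => v s 0 2) (-1) = v (-1) 0 2 / 2 ∧ v (-1) 0 2 * (Δ (fun y => v (-1) y 2)) 0 ≤ 0) :=
  fun C v hrate hcont hmild _ hne hhot =>
    ⟨threadTimePin hrate hcont hmild hne hhot, threadSpacePin hrate hcont hmild hne hhot⟩


/-! ### v6 — the FREE growth exponent κ = 3/2 (idea-crit-7 10:06:56Z (2), KEY-NS #126 (1))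

After I9 (C⁺ false on the heat stratum, conceded by ns-idea-1 10:06:19Z) the comparison step of `LoopPeriodRatchet` is to be
re-typed in EXPONENT form and MERGED BY NAME with this line's S6G `stub_frequencyGrowthExponent` («∃ A > 0, κ < 3/2, …»).  The critic
asks that the TRIVIAL exponent be a named, proved support so that the open content is exactly the gap `κ < 3/2`.  It already is a tree
theorem: weak Yorke (`one_le_lip_mul_period'` above: `1 ≤ L·T`) + KNSS smoothing (`Theorems.exists_norm_iteratedFDeriv_le_of_typeI`:
`‖∇curl v(s)‖_∞ ≤ C_M(−s)^{−3/2}` on the Type-I ancient Oseen-mild class) give `Θ_sup(s) ≤ M(−s)^{−3/2}` with `M` uniform in the class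
constant — which is VERBATIM `LoopPeriodRatchet.PeriodScalingBound` (stmt-NavierStokesRegularity-22494), PROVED by
`Theorems.LoopPeriodRatchetPeriodScalingBound.periodScalingBound_proof` (ns-idea-1's lineage) and consumed in the thread_axis skeleton as
`periodFloorYorke` (S6Y).  We only NAME it here in growth-exponent words; nothing new is proved and no summit is touched. -/

/-- **κ = 3/2 IS FREE** (alias, sorry-free): the sup over non-stationary closed vortex lines of the inverse period of a Type-I ancient
Oseen-mild profile is `≤ M(−s)^{−3/2}`, `M = M(C)` uniform in the class — the tree's PROVED `PeriodScalingBound`.  S6G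
`stub_frequencyGrowthExponent` is stated AGAINST this: it asks for an exponent `κ < 3/2` in the two-time (ratchet-with-slack) form. -/
theorem growthExponent_threeHalves :
    Summit.NavierStokesRegularity.NavierStokesRegularity.Theses.LoopPeriodRatchet.PeriodScalingBound :=
  Summit.NavierStokesRegularity.NavierStokesRegularity.Theorems.LoopPeriodRatchetPeriodScalingBound.periodScalingBound_proof

/-- The same ceiling unfolded, per class constant `C`: `ℓ⁻¹ ≤ M · (−s)^{−3/2}` for every non-stationary `ℓ`-periodic vortex line at
every time `s < 0` of every profile of the class. [cite: KochNadirashviliSereginSverak2009 §4 (4.10); Yorke 1969 (weak form)] -/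
theorem frequencyCeiling_threeHalves (C : ℝ) :
    ∃ M : ℝ, ∀ (v : ℝ → EuclideanSpace ℝ (Fin 3) → EuclideanSpace ℝ (Fin 3)),
      Literature.Analysis.FluidPDE.HasTypeITimeDecay C v →
      ContinuousOn (Function.uncurry v) (Set.Iio (0 : ℝ) ×ˢ Set.univ) →
      (∀ s t : ℝ, s < t → t < 0 → ∀ x, v t x =
        Literature.Analysis.UnboundedOperators.heatExtension (v s) (t - s) x -
          Literature.Analysis.FluidPDE.oseenDuhamel 1 s v v t x) →
      (∀ t < 0, Literature.Analysis.FluidPDE.VectorCalculus.IsDivFree (v t)) →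
      ∀ s : ℝ, s < 0 → ∀ (γ : ℝ → EuclideanSpace ℝ (Fin 3)) (ℓ : ℝ), 0 < ℓ →
        (∀ θ, HasDerivAt γ (Literature.Analysis.FluidPDE.curl (v s) (γ θ)) θ) →
        (∀ θ, γ (θ + ℓ) = γ θ) → Literature.Analysis.FluidPDE.curl (v s) (γ 0) ≠ 0 →
        ℓ⁻¹ ≤ M * (-s) ^ (-(3 : ℝ) / 2) :=
  growthExponent_threeHalves C

end Summit.NavierStokesRegularity.NavierStokesRegularity.Cruxes.PoloidalWindowRigidity.ThreadAxis.Rung
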